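import Mathlib
import HarnessLib
import Summits.CriticalPhenomena.Ising3DConformalLimit.Theses.ArmDressing
import Summits.CriticalPhenomena.Ising3DConformalLimit.Theorems.ArmDressingEvenPatternDecouplingArmBoxLimits
import Summits.CriticalPhenomena.Ising3DConformalLimit.Theorems.ArmDressingEvenPatternDecouplingPatternTransferDet
import Summits.CriticalPhenomena.Ising3DConformalLimit.Theorems.ArmDressingEvenPatternDecouplingHybridRatioChain

/-!
# Crux `EvenPatternDecoupling` (stmt-CriticalPhenomena-16133), line `registered`, stub `stub_kestenArmMixingGlue`

The heart [M'] of the line (Kesten's one-arm TV mixing with a buffer for `n` reading balls jointly) from its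
canonical lattice form [K] `stub_oneArmRatioMixing` (single-ball RATIO MIXING uniform in the far data; OPEN in
`d = 3`: uniqueness of the one-arm IIC, Panis 2025 OP1; planar: Kesten 1986, Camia–Feng 2025 Lemma 12) and the
LANDED hybrid argument [Hyb] `stub_hybridRatioChain` (p164679): radii bookkeeping, far-measurability of the other
balls' arm events by first-exit walk surgery (`armEvent_iff_of_agree`) and uniform separation of the outer balls
(`exists_gap_of_disjoint`), positivity of the joint point-arm event (`stub_armBoxLimits`, p149935). The registered
signature is `([K]) → ([M'])` with [M']'s unused `let`-binders dropped (the same proposition).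
-/

namespace Summit.CriticalPhenomena.Ising3DConformalLimit.Theorems.EvenPatternDecoupling

open scoped Topology
open Filter Set Metric
open Literature.Probability.LatticeModels Literature.Probability.Percolation Literature.Barriers.CriticalPhenomena

/-- A coordinate difference of two lattice sites is controlled by the distance of their mesh-`δ` images. -/
theorem mul_abs_sub_le_dist_mesh {δ : ℝ} (hδ : 0 ≤ δ) (x y : Site 3) (i : Fin 3) :
    δ * |((y i : ℤ) : ℝ) - (x i : ℝ)| ≤
      dist (WithLp.toLp 2 fun j : Fin 3 => δ * (y j : ℝ) : EuclideanSpace ℝ (Fin 3))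
        (WithLp.toLp 2 fun j : Fin 3 => δ * (x j : ℝ)) := by
  have h := PiLp.dist_apply_le (WithLp.toLp 2 fun j : Fin 3 => δ * (y j : ℝ) : EuclideanSpace ℝ (Fin 3))
    (WithLp.toLp 2 fun j : Fin 3 => δ * (x j : ℝ)) i
  have h' : dist (δ * (y i : ℝ)) (δ * (x i : ℝ)) = δ * |((y i : ℤ) : ℝ) - (x i : ℝ)| := by
    rw [Real.dist_eq, ← mul_sub, abs_mul, abs_of_nonneg hδ]
  rw [← h']
  exact h

/-- A discretised closed Euclidean ball lies in a sup-norm lattice ball around any site whose mesh image is close to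
its centre: `dist(δx, p) + R ≤ δ m ⇒ {y | δy ∈ B̄(p, R)} ⊆ B_m(x)`. -/
theorem disc_closedBall_subset_latticeBall {δ : ℝ} (hδ : 0 < δ) (x : Site 3) (p : EuclideanSpace ℝ (Fin 3))
    (R : ℝ) (m : ℕ)
    (h : dist (WithLp.toLp 2 fun j : Fin 3 => δ * (x j : ℝ) : EuclideanSpace ℝ (Fin 3)) p + R ≤ δ * m) :
    {y : Site 3 | (WithLp.toLp 2 fun j : Fin 3 => δ * (y j : ℝ) : EuclideanSpace ℝ (Fin 3)) ∈ closedBall p R} ⊆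
      {y : Site 3 | ∀ i, |y i - x i| ≤ m} := by
  intro y hy i
  rw [mem_setOf_eq, mem_closedBall] at hy
  have h1 := mul_abs_sub_le_dist_mesh hδ.le x y i
  have h2 : dist (WithLp.toLp 2 fun j : Fin 3 => δ * (y j : ℝ) : EuclideanSpace ℝ (Fin 3))
      (WithLp.toLp 2 fun j : Fin 3 => δ * (x j : ℝ)) ≤ δ * m := by
    have := dist_triangle (WithLp.toLp 2 fun j : Fin 3 => δ * (y j : ℝ) : EuclideanSpace ℝ (Fin 3)) p
      (WithLp.toLp 2 fun j : Fin 3 => δ * (x j : ℝ))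
    rw [dist_comm p] at this
    linarith
  have h3 : |((y i : ℤ) : ℝ) - (x i : ℝ)| ≤ m := le_of_mul_le_mul_left (h1.trans h2) hδ
  have h4 : (|y i - x i| : ℤ) ≤ (m : ℤ) := by
    have : ((|y i - x i| : ℤ) : ℝ) ≤ ((m : ℤ) : ℝ) := by push_cast; exact h3
    exact_mod_cast this
  exact h4

/-- Mesh images of the sites of a sup-norm lattice ball `B_M(x)` are within `2δM` of the mesh image of `x`. -/
theorem dist_mesh_le_of_mem_latticeBall {δ : ℝ} (hδ : 0 ≤ δ) {x y : Site 3} {M : ℕ}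
    (hy : ∀ i, |y i - x i| ≤ M) :
    dist (WithLp.toLp 2 fun j : Fin 3 => δ * (y j : ℝ) : EuclideanSpace ℝ (Fin 3))
      (WithLp.toLp 2 fun j : Fin 3 => δ * (x j : ℝ)) ≤ 2 * (δ * M) := by
  refine Summit.CriticalPhenomena.Ising3DConformalLimit.Theorems.EvenPatternDecoupling.dist_euclidean_le_two_mul
    (by positivity) fun i => ?_
  show dist (δ * (y i : ℝ)) (δ * (x i : ℝ)) ≤ δ * M
  rw [Real.dist_eq, ← mul_sub, abs_mul, abs_of_nonneg hδ]
  refine mul_le_mul_of_nonneg_left ?_ hδ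
  have h := hy i
  have : ((|y i - x i| : ℤ) : ℝ) ≤ ((M : ℤ) : ℝ) := by exact_mod_cast h
  push_cast at this
  exact this

/-- A sup-norm lattice ball lies in the box `Λ_L` eventually in `L`. -/
theorem eventually_latticeBall_subset_box (x : Site 3) (R : ℕ) :
    ∀ᶠ L : ℕ in atTop, {y : Site 3 | ∀ i, |y i - x i| ≤ R} ⊆ (box 3 L : Set (Site 3)) := by
  refine Filter.eventually_atTop.2 ⟨(Finset.univ.sup fun i => (x i).natAbs) + R, fun L hL y hy => ?_⟩
  rw [Finset.mem_coe, mem_box]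
  intro i
  have h1 : |y i - x i| ≤ R := hy i
  have h2 : (x i).natAbs ≤ Finset.univ.sup fun i => (x i).natAbs :=
    Finset.le_sup (f := fun i => (x i).natAbs) (Finset.mem_univ i)
  have h3 : |x i| ≤ ((Finset.univ.sup fun i => (x i).natAbs : ℕ) : ℤ) := by
    rw [Int.abs_eq_natAbs]; exact_mod_cast h2
  rw [abs_le] at h1 h3
  constructor <;> omega

/-- Pairwise disjoint closed balls of a finite family in `ℝ³` are uniformly separated: there is `κ > 0` such that a
point within `κ` of the `j`-th ball is outside the `k`-th ball, `k ≠ j`. -/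
theorem exists_gap_of_disjoint {n : ℕ} (c : Fin n → EuclideanSpace ℝ (Fin 3)) (r : Fin n → ℝ)
    (hd : ∀ j k, j ≠ k → Disjoint (closedBall (c j) (r j)) (closedBall (c k) (r k))) :
    ∃ κ : ℝ, 0 < κ ∧ ∀ j k, j ≠ k → ∀ p q : EuclideanSpace ℝ (Fin 3), p ∈ closedBall (c j) (r j) →
      dist p q ≤ κ → q ∉ closedBall (c k) (r k) := by
  have hpair : ∀ j k, ∀ᶠ κ in 𝓝[>] (0 : ℝ), j ≠ k → ∀ p q : EuclideanSpace ℝ (Fin 3),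
      p ∈ closedBall (c j) (r j) → dist p q ≤ κ → q ∉ closedBall (c k) (r k) := by
    intro j k
    by_cases hjk : j = k
    · exact Filter.Eventually.of_forall fun κ h => absurd hjk h
    obtain ⟨d, hd0, hdisj⟩ := (hd j k hjk).exists_cthickenings (isCompact_closedBall _ _) isClosed_closedBall
    have hev : ∀ᶠ κ in 𝓝[>] (0 : ℝ), κ ≤ d :=
      (eventually_le_nhds hd0).filter_mono nhdsWithin_le_nhds
    filter_upwards [hev] with κ hκ _ p q hp hpq hq
    have hq' : q ∈ cthickening d (closedBall (c j) (r j)) :=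
      mem_cthickening_of_dist_le q p d _ hp (by rw [dist_comm]; exact hpq.trans hκ)
    exact (Set.disjoint_left.1 hdisj) hq' (self_subset_cthickening _ hq)
  obtain ⟨κ, hκ, hall⟩ := ((eventually_all.2 fun j => eventually_all.2 fun k => hpair j k).and
    self_mem_nhdsWithin).exists
  exact ⟨κ, hall, fun j k hjk => hκ j k hjk⟩

/-- A positive common lower bound of finitely many positive reals. -/
theorem exists_pos_le_forall {n : ℕ} (t : Fin n → ℝ) (ht : ∀ j, 0 < t j) :
    ∃ τ : ℝ, 0 < τ ∧ ∀ j, τ ≤ t j := by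
  have hev : ∀ᶠ τ in 𝓝[>] (0 : ℝ), ∀ j, τ ≤ t j :=
    eventually_all.2 fun j => (eventually_le_nhds (ht j)).filter_mono nhdsWithin_le_nhds
  exact (hev.and self_mem_nhdsWithin).exists.imp fun τ h => ⟨h.2, h.1⟩

/-- For every `ε > 0` and `n` there is `ε' > 0` with `(1 + ε')ⁿ - 1 ≤ ε` (continuity at `0`). -/
theorem exists_pow_sub_one_le (ε : ℝ) (hε : 0 < ε) (n : ℕ) :
    ∃ ε' : ℝ, 0 < ε' ∧ (1 + ε') ^ n - 1 ≤ ε := by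
  have hcont : Tendsto (fun e : ℝ => (1 + e) ^ n - 1) (𝓝[>] 0) (𝓝 0) := by
    have h : Tendsto (fun e : ℝ => (1 + e) ^ n - 1) (𝓝 0) (𝓝 ((1 + 0) ^ n - 1)) :=
      (((continuous_const.add continuous_id).pow n).sub continuous_const).tendsto 0
    rw [add_zero, one_pow, sub_self] at h
    exact h.mono_left nhdsWithin_le_nhds
  exact ((hcont.eventually_lt_const hε).and self_mem_nhdsWithin).exists.imp fun e h => ⟨h.2, h.1.le⟩

/-- `⌊a/δ⌋₊ → ∞` as `δ → 0⁺`. -/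
theorem tendsto_floor_div_nhdsGT {a : ℝ} (ha : 0 < a) :
    Tendsto (fun δ : ℝ => ⌊a / δ⌋₊) (𝓝[>] 0) atTop := by
  have ht : Tendsto (fun δ : ℝ => a / δ) (𝓝[>] 0) atTop := by
    have h := Filter.Tendsto.const_mul_atTop ha tendsto_inv_nhdsGT_zero
    refine h.congr' ?_
    filter_upwards with δ
    simp [div_eq_mul_inv]
  exact tendsto_nat_floor_atTop.comp ht

/-- **First-exit transfer (one direction).** Let `D` ("domain") and `Q` ("blind zone") be disjoint vertex
sets such that no `Γ`-edge joins `D` to `Q`. If `ω ⊆ E(Γ)` and `ω, ω'` agree on all pairs avoiding `Q`, then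
an `ω`-open path from a vertex of `D` to a vertex outside `D` yields an `ω'`-open path from the same start to
some vertex outside `D` (follow the path up to its first exit from `D`: all its edges touch `D`, hence avoid
`Q`). -/
theorem exists_exit_reachable_of_agree {V : Type*} (Γ : SimpleGraph V) (D Q : Set V)
    (hDQ : Disjoint D Q) (hsep : ∀ u v : V, u ∈ D → Γ.Adj u v → v ∉ Q)
    {ω ω' : Set (Sym2 V)} (hω : ω ⊆ Γ.edgeSet)
    (hag : ∀ u v : V, u ∉ Q → v ∉ Q → (s(u, v) ∈ ω ↔ s(u, v) ∈ ω'))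
    {a b : V} (ha : a ∈ D) (hb : b ∉ D) (h : (openGraph ω).Reachable a b) :
    ∃ b' : V, b' ∉ D ∧ (openGraph ω').Reachable a b' := by
  obtain ⟨p⟩ := h
  induction p with
  | nil => exact absurd ha hb
  | @cons u w _ hadj p ih =>
    have hmem : s(u, w) ∈ ω := ((openGraph_adj ω u w).1 hadj).1
    have hne : u ≠ w := ((openGraph_adj ω u w).1 hadj).2
    have hΓ : Γ.Adj u w := by
      have := hω hmem
      rwa [SimpleGraph.mem_edgeSet] at this
    have huQ : u ∉ Q := Set.disjoint_left.1 hDQ ha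
    have hwQ : w ∉ Q := hsep u w ha hΓ
    have hmem' : s(u, w) ∈ ω' := (hag u w huQ hwQ).1 hmem
    have hadj' : (openGraph ω').Adj u w := (openGraph_adj ω' u w).2 ⟨hmem', hne⟩
    by_cases hw : w ∈ D
    · obtain ⟨b', hb', hr⟩ := ih hw hb
      exact ⟨b', hb', hadj'.reachable.trans hr⟩
    · exact ⟨w, hw, hadj'.reachable⟩

/-- **Arm events are determined away from a separated blind zone.** With `S ⊆ D`, `D ∩ Q = ∅` and no
`Γ`-edge from `D` to `Q`: for configurations made of `Γ`-edges that agree on all pairs avoiding `Q`, the event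
"some vertex of `S` is joined by an open path to some vertex outside `D`" has the same truth value. -/
theorem armEvent_iff_of_agree {V : Type*} (Γ : SimpleGraph V) (D Q S : Set V) (hS : S ⊆ D)
    (hDQ : Disjoint D Q) (hsep : ∀ u v : V, u ∈ D → Γ.Adj u v → v ∉ Q)
    (ω ω' : Set (Sym2 V)) (hω : ω ⊆ Γ.edgeSet) (hω' : ω' ⊆ Γ.edgeSet)
    (hag : ∀ u v : V, u ∉ Q → v ∉ Q → (s(u, v) ∈ ω ↔ s(u, v) ∈ ω')) :
    (∃ a b : V, a ∈ S ∧ b ∈ Dᶜ ∧ (openGraph ω).Reachable a b) ↔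
      (∃ a b : V, a ∈ S ∧ b ∈ Dᶜ ∧ (openGraph ω').Reachable a b) := by
  constructor
  · rintro ⟨a, b, ha, hb, h⟩
    obtain ⟨b', hb', h'⟩ := exists_exit_reachable_of_agree Γ D Q hDQ hsep hω hag (hS ha) hb h
    exact ⟨a, b', ha, hb', h'⟩
  · rintro ⟨a, b, ha, hb, h⟩
    have hag' : ∀ u v : V, u ∉ Q → v ∉ Q → (s(u, v) ∈ ω' ↔ s(u, v) ∈ ω) :=
      fun u v hu hv => (hag u v hu hv).symm
    obtain ⟨b', hb', h'⟩ := exists_exit_reachable_of_agree Γ D Q hDQ hsep hω' hag' (hS ha) hb h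
    exact ⟨a, b', ha, hb', h'⟩

-- lint debt by design: the registered signature carries an unused `let`-binder (`L` in `Out`); the header is the
-- registered stub signature (whitespace-compressed, token-identical to `([K]) → ([M'])` minus unused lets)
set_option linter.unusedVariables false in
set_option maxHeartbeats 2000000 in
/-- **Stub `stub_kestenArmMixingGlue` of the line skeleton (lead, proved): [K] `stub_oneArmRatioMixing` implies [M']
(Kesten's one-arm TV mixing with a buffer for `n` reading balls jointly), using the landed [Hyb] `stub_hybridRatioChain`.**
Given the reading family `(z₀, t)` and `ε`: pick `ε'` with `(1+ε')ⁿ - 1 ≤ ε`, `(λ, m₀)` from [K] at `ε'`, the uniform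
separation `κ` of the outer balls, `ρ := min t / (64(λ+1))`, `V := ∏ B(z₀_j, ρ)`, `η₀ := ρ`; for `δ` small
(`δ ≤ ρ`, `4δ ≤ s_j`, `δ < κ/4`, `m := ⌊2ρ/δ⌋₊ + 3 ≥ m₀`) and `L` large (blind balls `B_{λm+1}(x_k)` in the box, joint
point-arm event of positive mass), apply [Hyb] at volume `L` with the point/ball arm events of the `n` balls, the far
predicates "determined off `B_{λm}(x_k)` on box-supported configurations", and [K] as the single-ball input. -/
theorem stub_kestenArmMixingGlue : (open Literature.Probability.LatticeModels Literature.Probability.Percolation Literature.Barriers.CriticalPhenomena in let μ : (L : ℕ)→MeasureTheory.Measure (BondConfig (BoxV 3 L)):=fun L=>rcMeasure (boxGraph 3 L) (fkIsingParam (criticalBeta 3)) 2 (boxBoundary 3 L); let Conn : (L : ℕ)→Set (Site 3)→Set (Site 3)→Set (BondConfig (BoxV 3 L)):=fun L S T=>{ω | ∃ a b : BoxV 3 L, a.1 ∈ S ∧ b.1 ∈ T ∧ (openGraph ω).Reachable a b}; let Bx : Site 3→ℕ→Set (Site 3):=fun x m=>{y | ∀ i, |y i - x i| ≤ m}; let FarEv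 : (L : ℕ)→Set (Site 3)→Set (BondConfig (BoxV 3 L))→Prop:=fun L Q F=>∀ ω ω' : BondConfig (BoxV 3 L), ω ⊆ (boxGraph 3 L).edgeSet→ω' ⊆ (boxGraph 3 L).edgeSet→(∀ u v : BoxV 3 L, u.1 ∉ Q→v.1 ∉ Q→(s(u, v) ∈ ω ↔ s(u, v) ∈ ω'))→(ω ∈ F ↔ ω' ∈ F); ∀ ε : ℝ, 0 < ε→∃ lam m₀ : ℕ, ∀ m : ℕ, m₀ ≤ m→∀ M : ℕ, lam * m ≤ M→∀ (L : ℕ) (x : Site 3) (S T T' : Set (Site 3)), x ∈ S→S ⊆ Bx x m→Bx x (M + 1) ⊆ (box 3 L : Set (Site 3))→Disjoint T (Bx x M)→Disjoint T' (Bx x M)→∀ F F' : Set (BondConfig (BoxV 3 L)), FarEv L (Bx x M) F→FarEv L (Bx x M) F'→(μ L).real (F ∩ Conn L {x} T) * (μ L).real (F' ∩ Conn L S T') ≤ (1 + ε) * ((μ L).real (F' ∩ Conn L {x} T') * (μ L).real (F ∩ Conn L S T)))→(open Literature.Probability.LatticeModels Literature.Probability.Percolation Literature.Barriers.CriticalPhenomena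 Filter Topology in let E3:=EuclideanSpace ℝ (Fin 3); let μ : (L : ℕ)→MeasureTheory.Measure (BondConfig (BoxV 3 L)):=fun L=>rcMeasure (boxGraph 3 L) (fkIsingParam (criticalBeta 3)) 2 (boxBoundary 3 L); let mesh : ℝ→Site 3→E3:=fun δ z=>WithLp.toLp 2 fun i : Fin 3=>δ * (z i : ℝ); let disc : ℝ→Set E3→Set (Site 3):=fun δ A=>{x | mesh δ x ∈ A}; let CROSS : (n : ℕ)→Set (Fin (n + n)→Fin (n + n)→Prop):=fun n=>{R | ∀ i : Fin n, R (Fin.castAdd n i) (Fin.natAdd n i)}; let pts : (n : ℕ)→ℝ→(Fin n→E3)→(Fin n→Set (Site 3)):=fun _ δ z j=>{latticeApprox δ (z j)}; let fam : (n : ℕ)→ℝ→(Fin n→Set E3)→(Fin n→Set E3)→(Fin (n + n)→Set (Site 3)):=fun _ δ A B=>Fin.append (fun j=>disc δ (A j)) (fun j=>disc δ (B j)); let Ev : (m : ℕ)→(Fin m→Set (Site 3))→Set (Fin m→Fin m→Prop)→(L : ℕ)→Set (BondConfig (BoxV 3 L)):=fun _ K R L=>{ω | (fun i j=>∃ x y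 : BoxV 3 L, x.1 ∈ K i ∧ y.1 ∈ K j ∧ (openGraph ω).Reachable x y) ∈ R}; let Out : (n : ℕ)→ℝ→(Fin n→E3)→(Fin n→ℝ)→(L : ℕ)→Set (BoxV 3 L):=fun _ δ b s L=>{x | ∀ k, mesh δ x.1 ∉ Metric.closedBall (b k) (s k)}; ∀ (n : ℕ), 2 ≤ n→Even n→∀ (c : Fin n→E3) (r : Fin n→ℝ), (∀ j, 0 < r j)→(∀ j k, j ≠ k→Disjoint (Metric.closedBall (c j) (r j)) (Metric.closedBall (c k) (r k)))→∀ z₀ : Fin n→E3, (∀ j, z₀ j ∈ Metric.ball (c j) (r j))→∀ t : Fin n→ℝ, (∀ j, 0 < t j)→(∀ j, Metric.closedBall (z₀ j) (t j) ⊆ Metric.ball (c j) (r j))→∀ ε : ℝ, 0 < ε→∃ V ∈ 𝓝 z₀, ∃ η₀ : ℝ, 0 < η₀ ∧ ∀ (b : Fin n→E3) (s : Fin n→ℝ), (∀ j, 0 < s j ∧ s j < η₀)→(∀ j, Metric.closedBall (b j) (s j) ⊆ Metric.ball (z₀ j) (t j / 2))→∀ᶠ δ in 𝓝[>] 0, ∀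 z ∈ V, (∀ j, z j ∈ Metric.ball (b j) (s j / 2))→∀ E : (L : ℕ)→Set (BondConfig (BoxV 3 L)), (∀ (L : ℕ) (ω ω' : BondConfig (BoxV 3 L)), (∀ x y : BoxV 3 L, x ∈ Out n δ z₀ t L→y ∈ Out n δ z₀ t L→(s(x, y) ∈ ω ↔ s(x, y) ∈ ω'))→(ω ∈ E L ↔ ω' ∈ E L))→∀ᶠ L in atTop, |(μ L).real (E L ∩ Ev (n + n) (Fin.append (pts n δ z) (fun j=>disc δ (Metric.ball (c j) (r j))ᶜ)) (CROSS n) L) / (μ L).real (Ev (n + n) (Fin.append (pts n δ z) (fun j=>disc δ (Metric.ball (c j) (r j))ᶜ)) (CROSS n) L) - (μ L).real (E L ∩ Ev (n + n) (fam n δ (fun j=>Metric.closedBall (b j) (s j)) (fun j=>(Metric.ball (c j) (r j))ᶜ)) (CROSS n) L) / (μ L).real (Ev (n + n) (fam n δ (fun j=>Metric.closedBall (b j) (s j)) (fun j=>(Metric.ball (c j) (r j))ᶜ)) (CROSS n) L)| ≤ ε) := by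
  intro hK E3 μ mesh disc CROSS pts fam Ev Out n hn hev c r hr hdisj z₀ hz₀ t ht htadm ε hε
  have hH := @stub_hybridRatioChain
  -- constants
  obtain ⟨ε', hε', hpow⟩ := exists_pow_sub_one_le ε hε n
  obtain ⟨lam, m₀, hKε⟩ := hK ε' hε'
  obtain ⟨τ, hτ, hτt⟩ := exists_pos_le_forall t ht
  obtain ⟨κ, hκ, hgap⟩ := exists_gap_of_disjoint c r hdisj
  have hlam0 : (0:ℝ) ≤ lam := Nat.cast_nonneg lam
  set ρ : ℝ := τ / (64 * ((lam : ℝ) + 1)) with hρ_def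
  have hρ : 0 < ρ := by positivity
  have hρτ : 64 * ((lam : ℝ) + 1) * ρ = τ := by
    rw [hρ_def]; field_simp
  -- the neighbourhood `V = ∏ B(z₀ j, ρ)` and `η₀ = ρ`
  have hopen : IsOpen {z : Fin n → E3 | ∀ j, z j ∈ ball (z₀ j) ρ} := by
    have hEq : {z : Fin n → E3 | ∀ j, z j ∈ ball (z₀ j) ρ} =
        ⋂ j, (fun z : Fin n → E3 => z j) ⁻¹' ball (z₀ j) ρ := by
      ext z; simp
    rw [hEq]
    exact isOpen_iInter_of_finite fun j => isOpen_ball.preimage (continuous_apply j)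
  refine ⟨{z | ∀ j, z j ∈ ball (z₀ j) ρ}, hopen.mem_nhds (fun j => mem_ball_self hρ), ρ, hρ,
    fun b s hs hbs => ?_⟩
  -- eventualities in `δ`
  have hδpos : ∀ᶠ δ in 𝓝[>] (0:ℝ), 0 < δ := self_mem_nhdsWithin
  have hδρ : ∀ᶠ δ in 𝓝[>] (0:ℝ), δ ≤ ρ := (eventually_le_nhds hρ).filter_mono nhdsWithin_le_nhds
  have hδκ : ∀ᶠ δ in 𝓝[>] (0:ℝ), δ < κ / 4 :=
    (eventually_lt_nhds (by positivity : (0:ℝ) < κ / 4)).filter_mono nhdsWithin_le_nhds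
  have hδs : ∀ᶠ δ in 𝓝[>] (0:ℝ), ∀ j, 4 * δ ≤ s j := by
    refine eventually_all.2 fun j => ?_
    have h : ∀ᶠ δ in 𝓝 (0:ℝ), δ ≤ s j / 4 := eventually_le_nhds (by linarith [(hs j).1])
    exact (h.filter_mono nhdsWithin_le_nhds).mono fun δ hδ => by linarith
  have hδm : ∀ᶠ δ in 𝓝[>] (0:ℝ), m₀ ≤ ⌊2 * ρ / δ⌋₊ + 3 := by
    have h := (tendsto_floor_div_nhdsGT (by positivity : (0:ℝ) < 2 * ρ)).eventually_ge_atTop m₀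
    exact h.mono fun δ hδ => hδ.trans (Nat.le_add_right _ _)
  filter_upwards [hδpos, hδρ, hδκ, hδs, hδm] with δ hδ hδρ' hδκ' hδs' hδm' z hz hzin E hE
  have hzρ : ∀ j, z j ∈ ball (z₀ j) ρ := hz
  -- the lattice scales `m ≍ 2ρ/δ`, `M = lam·m`
  set m : ℕ := ⌊2 * ρ / δ⌋₊ + 3 with hm_def
  have hm_le : δ * m ≤ 2 * ρ + 3 * δ := by
    have h1 : ((⌊2 * ρ / δ⌋₊ : ℕ) : ℝ) ≤ 2 * ρ / δ := Nat.floor_le (by positivity)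
    have h2 : (m : ℝ) = ((⌊2 * ρ / δ⌋₊ : ℕ) : ℝ) + 3 := by rw [hm_def]; push_cast; ring
    rw [h2, mul_add]
    have : δ * ((⌊2 * ρ / δ⌋₊ : ℕ) : ℝ) ≤ δ * (2 * ρ / δ) := mul_le_mul_of_nonneg_left h1 hδ.le
    rw [mul_div_cancel₀ _ hδ.ne'] at this
    linarith
  have hm_ge : 2 * ρ + 2 * δ ≤ δ * m := by
    have h1 : 2 * ρ / δ < ((⌊2 * ρ / δ⌋₊ : ℕ) : ℝ) + 1 := Nat.lt_floor_add_one _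
    have h2 : (m : ℝ) = ((⌊2 * ρ / δ⌋₊ : ℕ) : ℝ) + 3 := by rw [hm_def]; push_cast; ring
    have h3 : δ * (2 * ρ / δ) ≤ δ * (((⌊2 * ρ / δ⌋₊ : ℕ) : ℝ) + 1) := mul_le_mul_of_nonneg_left h1.le hδ.le
    rw [mul_div_cancel₀ _ hδ.ne'] at h3
    rw [h2]
    nlinarith
  -- the mesh radius of `B_{lam m + 1}(x_k)`
  have hMrad : 2 * (δ * (((lam * m + 1 : ℕ)) : ℝ)) ≤ τ / 4 - 3 * ρ := by
    have h1 : (((lam * m + 1 : ℕ)) : ℝ) = (lam : ℝ) * (m : ℝ) + 1 := by push_cast; ring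
    rw [h1]
    have h2 : δ * ((lam : ℝ) * (m : ℝ) + 1) = (lam : ℝ) * (δ * m) + δ := by ring
    rw [h2]
    have h3 : (lam : ℝ) * (δ * m) ≤ (lam : ℝ) * (2 * ρ + 3 * δ) := mul_le_mul_of_nonneg_left hm_le hlam0
    nlinarith
  -- (1) the sites `x_k` and the mesh images of `B_{lam m + 1}(x_k)` lie deep inside the reading balls
  have hxz : ∀ k, dist (mesh δ (latticeApprox δ (z k))) (z k) ≤ 2 * δ := fun k =>
    Summit.CriticalPhenomena.Ising3DConformalLimit.Theorems.EvenPatternDecoupling.dist_mesh_latticeApprox_le hδ (z k)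
  have hread : ∀ (k : Fin n) (y : Site 3), (∀ i, |y i - latticeApprox δ (z k) i| ≤ ((lam * m + 1 : ℕ) : ℤ)) →
      mesh δ y ∈ ball (z₀ k) (t k / 2) := by
    intro k y hy
    have h1 := dist_mesh_le_of_mem_latticeBall hδ.le hy
    have h2 := hxz k
    have h3 := mem_ball.1 (hzρ k)
    have h4 := hτt k
    rw [mem_ball]
    calc dist (mesh δ y) (z₀ k)
        ≤ dist (mesh δ y) (mesh δ (latticeApprox δ (z k))) + dist (mesh δ (latticeApprox δ (z k))) (z k) +
            dist (z k) (z₀ k) := dist_triangle4 _ _ _ _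
      _ < t k / 2 := by linarith
  have hreadM : ∀ (k : Fin n) (y : Site 3), (∀ i, |y i - latticeApprox δ (z k) i| ≤ ((lam * m : ℕ) : ℤ)) →
      mesh δ y ∈ ball (z₀ k) (t k / 2) := fun k y hy =>
    hread k y fun i => (hy i).trans (by push_cast; linarith)
  have hreadC : ∀ (k : Fin n) (y : Site 3), (∀ i, |y i - latticeApprox δ (z k) i| ≤ ((lam * m : ℕ) : ℤ)) →
      mesh δ y ∈ ball (c k) (r k) := fun k y hy =>
    htadm k (ball_subset_closedBall (mem_ball.2 (by
      have := mem_ball.1 (hreadM k y hy); linarith [ht k])))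
  have hxS : ∀ k, latticeApprox δ (z k) ∈ disc δ (closedBall (b k) (s k)) := by
    intro k
    show mesh δ (latticeApprox δ (z k)) ∈ closedBall (b k) (s k)
    rw [mem_closedBall]
    have h1 := hxz k
    have h2 := mem_ball.1 (hzin k)
    have h3 := hδs' k
    calc dist (mesh δ (latticeApprox δ (z k))) (b k)
        ≤ dist (mesh δ (latticeApprox δ (z k))) (z k) + dist (z k) (b k) := dist_triangle _ _ _
      _ ≤ s k := by linarith
  have hSB : ∀ k, disc δ (closedBall (b k) (s k)) ⊆ {y : Site 3 | ∀ i, |y i - latticeApprox δ (z k) i| ≤ (m : ℤ)} := by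
    intro k
    refine disc_closedBall_subset_latticeBall hδ (latticeApprox δ (z k)) (b k) (s k) m ?_
    have h1 := hxz k
    have h2 := mem_ball.1 (hzin k)
    have h3 := (hs k).2
    have h4 := dist_triangle (mesh δ (latticeApprox δ (z k))) (z k) (b k)
    linarith
  have hTdisj : ∀ k, Disjoint (disc δ (ball (c k) (r k))ᶜ) {y : Site 3 | ∀ i, |y i - latticeApprox δ (z k) i| ≤ ((lam * m : ℕ) : ℤ)} :=
    fun k => Set.disjoint_left.2 fun y hy hy' => hy (hreadC k y hy')
  -- (2) eventually in `L`: the blind balls lie in the box, and the joint point-arm event has positive mass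
  have hLbox : ∀ᶠ L : ℕ in atTop, ∀ k, {y : Site 3 | ∀ i, |y i - latticeApprox δ (z k) i| ≤ ((lam * m + 1 : ℕ) : ℤ)} ⊆
      (box 3 L : Set (Site 3)) :=
    eventually_all.2 fun k => eventually_latticeBall_subset_box (latticeApprox δ (z k)) (lam * m + 1)
  obtain ⟨⟨a, ha0, ha⟩, -⟩ :=
    Summit.CriticalPhenomena.Ising3DConformalLimit.Theorems.EvenPatternDecoupling.stub_armBoxLimits n c r b s z δ hδ
      (fun j => by linarith [hδs' j])
  have hLpos : ∀ᶠ L : ℕ in atTop, a / 2 < (μ L).real (Ev (n + n) (Fin.append (pts n δ z) fun j => disc δ (ball (c j) (r j))ᶜ) (CROSS n) L) :=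
    ha.eventually_const_lt (half_lt_self ha0)
  filter_upwards [hLbox, hLpos] with L hLb hLp
  -- (3) the hybrid argument at volume `L`
  have hp01 : fkIsingParam (criticalBeta 3) ∈ Set.Icc (0:ℝ) 1 := fkIsingParam_mem_Icc (criticalBeta_nonneg (d := 3))
  haveI : MeasureTheory.IsFiniteMeasure (μ L) := by
    haveI := isProbabilityMeasure_rcMeasure (boxGraph 3 L) hp01 two_pos (boxBoundary 3 L)
    show MeasureTheory.IsFiniteMeasure (rcMeasure (boxGraph 3 L) (fkIsingParam (criticalBeta 3)) 2 (boxBoundary 3 L))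
    infer_instance
  -- far-measurability helpers
  have hOutQ : ∀ (k : Fin n) (x : BoxV 3 L), x ∈ Out n δ z₀ t L →
      x.1 ∉ {y : Site 3 | ∀ i, |y i - latticeApprox δ (z k) i| ≤ ((lam * m : ℕ) : ℤ)} := by
    intro k x hx hxQ
    have h1 := mem_ball.1 (hreadM k x.1 hxQ)
    have h2 : mesh δ x.1 ∉ closedBall (z₀ k) (t k) := hx k
    exact h2 (mem_closedBall.2 (by linarith [ht k]))
  have hsepQ : ∀ (j k : Fin n), j ≠ k → ∀ u v : BoxV 3 L, mesh δ u.1 ∈ ball (c j) (r j) →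
      (boxGraph 3 L).Adj u v → v.1 ∉ {y : Site 3 | ∀ i, |y i - latticeApprox δ (z k) i| ≤ ((lam * m : ℕ) : ℤ)} := by
    intro j k hjk u v hu huv hvQ
    have hadj : (zdGraph 3).Adj u.1 v.1 := huv
    have h1 := Summit.CriticalPhenomena.Ising3DConformalLimit.Theorems.EvenPatternDecoupling.dist_mesh_le_of_adj hδ.le hadj
    have h2 : mesh δ v.1 ∈ closedBall (c k) (r k) := ball_subset_closedBall (hreadC k v.1 hvQ)
    exact hgap j k hjk (mesh δ u.1) (mesh δ v.1) (ball_subset_closedBall hu) (by linarith) h2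
  have hDQ : ∀ (j k : Fin n), j ≠ k →
      Disjoint {v : BoxV 3 L | mesh δ v.1 ∈ ball (c j) (r j)}
        {v : BoxV 3 L | v.1 ∈ {y : Site 3 | ∀ i, |y i - latticeApprox δ (z k) i| ≤ ((lam * m : ℕ) : ℤ)}} := by
    intro j k hjk
    refine Set.disjoint_left.2 fun v hvD hvQ => ?_
    exact (Set.disjoint_left.1 (hdisj j k hjk)) (ball_subset_closedBall hvD)
      (ball_subset_closedBall (hreadC k v.1 hvQ))
  have key := @hH (BondConfig (BoxV 3 L)) _ (μ L) inferInstance n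
    (fun k => {ω | ∃ a b' : BoxV 3 L, a.1 ∈ ({latticeApprox δ (z k)} : Set (Site 3)) ∧
      b'.1 ∈ disc δ (ball (c k) (r k))ᶜ ∧ (openGraph ω).Reachable a b'})
    (fun k => {ω | ∃ a b' : BoxV 3 L, a.1 ∈ disc δ (closedBall (b k) (s k)) ∧
      b'.1 ∈ disc δ (ball (c k) (r k))ᶜ ∧ (openGraph ω).Reachable a b'})
    (E L)
    (fun k F => ∀ ω ω' : BondConfig (BoxV 3 L), ω ⊆ (boxGraph 3 L).edgeSet → ω' ⊆ (boxGraph 3 L).edgeSet →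
      (∀ u v : BoxV 3 L, u.1 ∉ {y : Site 3 | ∀ i, |y i - latticeApprox δ (z k) i| ≤ ((lam * m : ℕ) : ℤ)} →
        v.1 ∉ {y : Site 3 | ∀ i, |y i - latticeApprox δ (z k) i| ≤ ((lam * m : ℕ) : ℤ)} →
        (s(u, v) ∈ ω ↔ s(u, v) ∈ ω')) → (ω ∈ F ↔ ω' ∈ F))
    ε' hε'.le
    (fun k ω ⟨a', b', ha', hb', hab⟩ => ⟨a', b', by
      rw [mem_singleton_iff] at ha'; rw [ha']; exact hxS k, hb', hab⟩)
    (fun k ω ω' hω hω' hag => hE L ω ω' fun x y hx hy => hag x y (hOutQ k x hx) (hOutQ k y hy))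
    (fun k ω ω' hω hω' hag => by simp)
    (fun k j hjk ω ω' hω hω' hag =>
      armEvent_iff_of_agree (boxGraph 3 L) {v : BoxV 3 L | mesh δ v.1 ∈ ball (c j) (r j)}
        {v : BoxV 3 L | v.1 ∈ {y : Site 3 | ∀ i, |y i - latticeApprox δ (z k) i| ≤ ((lam * m : ℕ) : ℤ)}}
        {v : BoxV 3 L | v.1 ∈ ({latticeApprox δ (z j)} : Set (Site 3))}
        (fun v hv => by
          have hv' : v.1 = latticeApprox δ (z j) := hv
          show mesh δ v.1 ∈ ball (c j) (r j)
          rw [hv']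
          exact hreadC j _ fun i => by simp only [sub_self, abs_zero]; positivity)
        (hDQ j k hjk) (fun u v hu huv => hsepQ j k hjk u v hu huv) ω ω' hω hω' hag)
    (fun k j hjk ω ω' hω hω' hag =>
      armEvent_iff_of_agree (boxGraph 3 L) {v : BoxV 3 L | mesh δ v.1 ∈ ball (c j) (r j)}
        {v : BoxV 3 L | v.1 ∈ {y : Site 3 | ∀ i, |y i - latticeApprox δ (z k) i| ≤ ((lam * m : ℕ) : ℤ)}}
        {v : BoxV 3 L | v.1 ∈ disc δ (closedBall (b j) (s j))}
        (fun v hv => by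
          have hv' : mesh δ v.1 ∈ closedBall (b j) (s j) := hv
          show mesh δ v.1 ∈ ball (c j) (r j)
          have h1 := mem_ball.1 (hbs j hv')
          exact htadm j (mem_closedBall.2 (by linarith [ht j])))
        (hDQ j k hjk) (fun u v hu huv => hsepQ j k hjk u v hu huv) ω ω' hω hω' hag)
    (fun k F G hF hG ω ω' hω hω' hag => by rw [mem_inter_iff, mem_inter_iff, hF ω ω' hω hω' hag, hG ω ω' hω hω' hag])
    (fun k F F' hF hF' => hKε m hδm' (lam * m) le_rfl L (latticeApprox δ (z k)) (disc δ (closedBall (b k) (s k)))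
      (disc δ (ball (c k) (r k))ᶜ) (disc δ (ball (c k) (r k))ᶜ) (hxS k) (hSB k) (hLb k) (hTdisj k) (hTdisj k)
      F F' hF hF')
    ?_
  · -- identify the two intersections with the crux's arm events and conclude
    have hA : (⋂ k, {ω : BondConfig (BoxV 3 L) | ∃ a b' : BoxV 3 L, a.1 ∈ ({latticeApprox δ (z k)} : Set (Site 3)) ∧
        b'.1 ∈ disc δ (ball (c k) (r k))ᶜ ∧ (openGraph ω).Reachable a b'}) =
        Ev (n + n) (Fin.append (pts n δ z) fun j => disc δ (ball (c j) (r j))ᶜ) (CROSS n) L := by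
      ext ω
      simp only [mem_iInter, mem_setOf_eq, Ev, CROSS, pts, Fin.append_left, Fin.append_right]
    have hB : (⋂ k, {ω : BondConfig (BoxV 3 L) | ∃ a b' : BoxV 3 L, a.1 ∈ disc δ (closedBall (b k) (s k)) ∧
        b'.1 ∈ disc δ (ball (c k) (r k))ᶜ ∧ (openGraph ω).Reachable a b'}) =
        Ev (n + n) (fam n δ (fun j => closedBall (b j) (s j)) fun j => (ball (c j) (r j))ᶜ) (CROSS n) L := by
      ext ω
      simp only [mem_iInter, mem_setOf_eq, Ev, CROSS, fam, Fin.append_left, Fin.append_right]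
    rw [hA, hB] at key
    exact key.trans hpow
  · -- positivity of the joint point-arm event at volume `L`
    have hA : (⋂ k, {ω : BondConfig (BoxV 3 L) | ∃ a b' : BoxV 3 L, a.1 ∈ ({latticeApprox δ (z k)} : Set (Site 3)) ∧
        b'.1 ∈ disc δ (ball (c k) (r k))ᶜ ∧ (openGraph ω).Reachable a b'}) =
        Ev (n + n) (Fin.append (pts n δ z) fun j => disc δ (ball (c j) (r j))ᶜ) (CROSS n) L := by
      ext ω
      simp only [mem_iInter, mem_setOf_eq, Ev, CROSS, pts, Fin.append_left, Fin.append_right]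
    rw [hA]
    exact lt_trans (half_pos ha0) hLp

end Summit.CriticalPhenomena.Ising3DConformalLimit.Theorems.EvenPatternDecoupling
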